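import Literature.Topology.FourManifolds.TubeRadial
import HarnessLib

/-!
# Exports of the radial zones: tangential derivative, quantitative invertibility, Euler defect

Topic `Literature/Topology/FourManifolds`; sequel of `TubeRadial.lean` (codimension `≥ 2` step of the
smoothing of PD homeomorphisms: Munkres, Ann. of Math. 72 (1960), §§4–5; Campbell–D'Onofrio–Vítek,
J. Geom. Anal. (2026), Lemma 3.2 Step 4 / Lemma 3.4 Step 3).  A later stage at a face of the
simplex reads the radial zones `φ p = (ρ ‖p.2‖) • Ψ (λ ‖p.2‖) p` of the present one and needs, at
each point, the three **pointwise exports** (`ExportAlgebra.lean`):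

* (E1) the tangential derivative: `Dφ p (v, 0) = (ρ t) • L (0, (v, 0))`, `L = D(uncurry Ψ)(λ t, p)`
  (`fderiv_radialFamilyMap_apply_inl`) — it carries the factor `t = ‖p.2‖` and vanishes for
  `x`-independent families (the diffeotopy part);
* (E2) **quantitative fibre invertibility** (`radialFamilyMap_fibre_lower_bound`):
  if the angular derivative of the stage is quantitatively nondegenerate,
  `w ⊥ y ⟹ κ‖w‖ ≤ t ‖L (0, (0, w))‖`, and `‖L (1, 0)‖ ≤ S`, `t |λ'(t)| ≤ ℓ`, then
  `ρ κ ‖w‖ ≤ (κ + 2 + ℓ S) ‖Dφ p (0, w)‖` for every `w` — the constant involves only `ρ`, the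
  black-box stage constants `κ, S` and the pacing speed `ℓ`, not `λ` itself;
* (E3) the Euler defect (`norm_radialFamilyMap_euler_defect_le`):
  `‖Dφ p (0, y) − φ p‖ ≤ ρ t ℓ S`, small by the SLOWNESS `ℓ` of the pacing.

Everything is proved; no definitions; no named facts.

## References

* J. R. Munkres, *Obstructions to the smoothing of piecewise-differentiable homeomorphisms*, Ann.
  of Math. (2) 72 (1960), 521–554, §§4–5. [Munkres1960]
* D. Campbell, L. D'Onofrio, T. Vítek, *Diffeomorphic approximation of piecewise affine
  homeomorphisms*, J. Geom. Anal. 36 (2026), Lemma 3.2 (Step 4), Lemma 3.4 (Step 3).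
  [CampbellDonofrioVitek2026]
-/

noncomputable section

open Set Function Metric Filter
open scoped Topology ContDiff RealInnerProductSpace

namespace Literature.Topology.FourManifolds

variable {E : Type*} [NormedAddCommGroup E] [NormedSpace ℝ E]
variable {F : Type*} [NormedAddCommGroup F] [InnerProductSpace ℝ F]
variable {ρ : ℝ} {Ψ : ℝ → E × F → F} {lam : ℝ → ℝ} {p : E × F}

/-- **(E1) The tangential derivative of the radial family map**:
`Dφ p (v, 0) = (ρ t) • L (0, (v, 0))` — the radial terms see only `⟪ŷ, 0⟫ = 0`. [folklore] -/
theorem fderiv_radialFamilyMap_apply_inl (hp : p.2 ≠ 0)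
    (hΨ : DifferentiableAt ℝ (uncurry Ψ) (lam ‖p.2‖, p)) {lam' : ℝ} (hlam : HasDerivAt lam lam' ‖p.2‖)
    (v : E) :
    fderiv ℝ (radialFamilyMap ρ Ψ lam) p (v, 0) =
      (ρ * ‖p.2‖) • fderiv ℝ (uncurry Ψ) (lam ‖p.2‖, p) (0, (v, (0 : F))) := by
  rw [(hasFDerivAt_radialFamilyMap (ρ := ρ) hp hΨ hlam).fderiv]
  change (ρ * ‖p.2‖) • fderiv ℝ (uncurry Ψ) (lam ‖p.2‖, p)
      (lam' • ⟪‖p.2‖⁻¹ • p.2, ((v, (0 : F)) : E × F).2⟫, (v, (0 : F))) +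
    (ρ • ⟪‖p.2‖⁻¹ • p.2, ((v, (0 : F)) : E × F).2⟫) • Ψ (lam ‖p.2‖) p = _
  simp only [inner_zero_right, smul_zero, zero_smul, add_zero]

/-- **(E3) The Euler defect of the radial family map is small by slowness**: for a unit family
homogeneous of degree zero, `‖Dφ p (0, y) − φ p‖ ≤ ρ ‖y‖ ℓ S` whenever `‖y‖ |λ'(‖y‖)| ≤ ℓ` and
`‖∂_sΨ‖ = ‖L (1, 0)‖ ≤ S` (`ρ ≥ 0`). [folklore] -/
theorem norm_radialFamilyMap_euler_defect_le (hp : p.2 ≠ 0) (hρ : 0 ≤ ρ)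
    (hΨ : DifferentiableAt ℝ (uncurry Ψ) (lam ‖p.2‖, p)) {lam' : ℝ}
    (hlam : HasDerivAt lam lam' ‖p.2‖)
    (hhom : ∀ᶠ c in 𝓝 (1 : ℝ), Ψ (lam ‖p.2‖) (p.1, c • p.2) = Ψ (lam ‖p.2‖) p)
    {ℓ S : ℝ} (hℓ : ‖p.2‖ * |lam'| ≤ ℓ) (hS : ‖fderiv ℝ (uncurry Ψ) (lam ‖p.2‖, p) (1, 0)‖ ≤ S) :
    ‖fderiv ℝ (radialFamilyMap ρ Ψ lam) p (0, p.2) - radialFamilyMap ρ Ψ lam p‖ ≤ ρ * ‖p.2‖ * ℓ * S := by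
  rw [radialFamilyMap_euler_defect hp hΨ hlam hhom, norm_smul, Real.norm_eq_abs]
  have hℓ0 : 0 ≤ ℓ := le_trans (mul_nonneg (norm_nonneg _) (abs_nonneg _)) hℓ
  have hS0 : 0 ≤ S := (norm_nonneg _).trans hS
  have h1 : |ρ * ‖p.2‖ ^ 2 * lam'| = ρ * ‖p.2‖ * (‖p.2‖ * |lam'|) := by
    rw [abs_mul, abs_mul, abs_of_nonneg hρ, abs_of_nonneg (sq_nonneg _)]; ring
  rw [h1]
  calc ρ * ‖p.2‖ * (‖p.2‖ * |lam'|) * ‖fderiv ℝ (uncurry Ψ) (lam ‖p.2‖, p) (1, 0)‖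
      ≤ ρ * ‖p.2‖ * ℓ * S := by
        have h0 : 0 ≤ ρ * ‖p.2‖ := mul_nonneg hρ (norm_nonneg _)
        calc ρ * ‖p.2‖ * (‖p.2‖ * |lam'|) * ‖fderiv ℝ (uncurry Ψ) (lam ‖p.2‖, p) (1, 0)‖
            ≤ ρ * ‖p.2‖ * ℓ * ‖fderiv ℝ (uncurry Ψ) (lam ‖p.2‖, p) (1, 0)‖ :=
              mul_le_mul_of_nonneg_right (mul_le_mul_of_nonneg_left hℓ h0) (norm_nonneg _)
          _ ≤ ρ * ‖p.2‖ * ℓ * S := mul_le_mul_of_nonneg_left hS (mul_nonneg h0 hℓ0)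

/-- **(E2) Quantitative fibre invertibility of the radial family map.** Let `p = (x, y)`,
`y ≠ 0`, `t = ‖y‖`, `ρ > 0`, `uncurry Ψ` differentiable at `(λ t, p)` with `‖Ψ‖ = 1` nearby and
homogeneous of degree zero in the fibre near `p`; write `L = D(uncurry Ψ)(λ t, p)`. Assume the
angular derivative is **quantitatively** nondegenerate — `w ⊥ y ⟹ κ ‖w‖ ≤ t ‖L (0, (0, w))‖` with
`κ > 0` (scale free: `t L(0,(0,·))` is the differential of the sphere stage) — and
`‖L (1, 0)‖ ≤ S`, `t |λ'| ≤ ℓ`.  Then for every `w`,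
`ρ κ ‖w‖ ≤ (κ + 2 + ℓ S) ‖Dφ p (0, w)‖`.  Proof: decompose `w = a ŷ + w⊥`; pairing `Dφ(0,w)`
with the unit vector `Ψ` isolates `ρ a` (the `L`-terms are `⊥ Ψ`), the radial part of
`L (0,(0,w))` vanishes by homogeneity, and the remainder `ρ t (λ' a ∂_sΨ + L(0,(0,w⊥)))` is
bounded by `2‖Dφ(0,w)‖`. [folklore] -/
theorem radialFamilyMap_fibre_lower_bound (hp : p.2 ≠ 0) (hρ : 0 < ρ)
    (hΨ : DifferentiableAt ℝ (uncurry Ψ) (lam ‖p.2‖, p))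
    (hunit : ∀ᶠ q in 𝓝 (lam ‖p.2‖, p), ‖uncurry Ψ q‖ = 1)
    (hhom : ∀ᶠ c in 𝓝 (1 : ℝ), Ψ (lam ‖p.2‖) (p.1, c • p.2) = Ψ (lam ‖p.2‖) p)
    {lam' : ℝ} (hlam : HasDerivAt lam lam' ‖p.2‖)
    {κ S ℓ : ℝ} (hκ : 0 < κ)
    (hang : ∀ w : F, ⟪p.2, w⟫ = 0 →
      κ * ‖w‖ ≤ ‖p.2‖ * ‖fderiv ℝ (uncurry Ψ) (lam ‖p.2‖, p) (0, ((0 : E), w))‖)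
    (hS : ‖fderiv ℝ (uncurry Ψ) (lam ‖p.2‖, p) (1, 0)‖ ≤ S) (hℓ : ‖p.2‖ * |lam'| ≤ ℓ) (w : F) :
    ρ * κ * ‖w‖ ≤ (κ + 2 + ℓ * S) * ‖fderiv ℝ (radialFamilyMap ρ Ψ lam) p (0, w)‖ := by
  -- notation
  set t : ℝ := ‖p.2‖ with ht
  have ht0 : 0 < t := norm_pos_iff.2 hp
  set L := fderiv ℝ (uncurry Ψ) (lam ‖p.2‖, p) with hL
  set ψ : F := Ψ (lam ‖p.2‖) p with hψ
  set yh : F := ‖p.2‖⁻¹ • p.2 with hyh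
  set a : ℝ := ⟪yh, w⟫ with ha
  set wp : F := w - a • yh with hwp
  set D : F := fderiv ℝ (radialFamilyMap ρ Ψ lam) p (0, w) with hD
  have hℓ0 : 0 ≤ ℓ := le_trans (mul_nonneg (norm_nonneg _) (abs_nonneg _)) hℓ
  have hS0 : 0 ≤ S := (norm_nonneg _).trans hS
  -- unit facts
  have hunit0 : ‖ψ‖ = 1 := hunit.self_of_nhds
  have hyh1 : ‖yh‖ = 1 := by
    rw [hyh, norm_smul, norm_inv, norm_norm, inv_mul_cancel₀ ht0.ne']
  have hperp : ∀ ξ, ⟪ψ, L ξ⟫ = 0 := fun ξ => inner_fderiv_unitFamily_eq_zero hΨ hunit ξ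
  -- `wp ⊥ y`
  have hwp_perp : ⟪p.2, wp⟫ = 0 := by
    have h1 : ⟪yh, yh⟫ = 1 := by rw [real_inner_self_eq_norm_sq, hyh1, one_pow]
    have h2 : ⟪yh, wp⟫ = 0 := by rw [hwp, inner_sub_right, inner_smul_right, h1, mul_one, ← ha, sub_self]
    have h3 : p.2 = t • yh := by
      rw [hyh, smul_smul, ht, mul_inv_cancel₀ ht0.ne', one_smul]
    rw [h3, inner_smul_left, h2]; simp
  -- the radial part of `L (0,(0,·))` vanishes: `L (0,(0,yh)) = 0`
  have hrad : L (0, ((0 : E), yh)) = 0 := by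
    have h0 : L (0, ((0 : E), p.2)) = 0 := fderiv_unitFamily_radial_eq_zero hΨ hhom
    have : (((0 : ℝ), ((0 : E), yh)) : ℝ × (E × F)) = ‖p.2‖⁻¹ • ((0 : ℝ), ((0 : E), p.2)) := by
      ext <;> simp [hyh]
    rw [this, map_smul, h0, smul_zero]
  -- the derivative formula, evaluated: `D = ρ a • ψ + (ρ t) • (λ' a • L(1,0) + L(0,(0,wp)))`
  have hDeq : D = (ρ * a) • ψ + (ρ * t) • ((lam' * a) • L (1, 0) + L (0, ((0 : E), wp))) := by
    have hform := (hasFDerivAt_radialFamilyMap (ρ := ρ) hp hΨ hlam).fderiv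
    rw [hD, hform]
    change (ρ * ‖p.2‖) • L (lam' • ⟪‖p.2‖⁻¹ • p.2, (((0 : E), w) : E × F).2⟫, (((0 : E), w) : E × F)) +
        (ρ • ⟪‖p.2‖⁻¹ • p.2, (((0 : E), w) : E × F).2⟫) • Ψ (lam ‖p.2‖) p = _
    simp only
    rw [← hyh, ← ha, ← hψ, ← ht]
    simp only [smul_eq_mul]
    -- split `L (λ' a, (0, w)) = (λ' a) • L (1,0) + L (0,(0,w))` and `w = wp + a • yh`
    have hsplit : L (lam' * a, ((0 : E), w)) = (lam' * a) • L (1, 0) + L (0, ((0 : E), wp)) := by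
      have hw : w = wp + a • yh := by rw [hwp, sub_add_cancel]
      have h1 : ((lam' * a, ((0 : E), w)) : ℝ × (E × F)) =
          (lam' * a) • ((1 : ℝ), ((0 : E), (0 : F))) + ((0 : ℝ), ((0 : E), wp)) +
            a • ((0 : ℝ), ((0 : E), yh)) := by
        ext <;> simp [hw]
      rw [h1, map_add, map_add, map_smul, map_smul, hrad, smul_zero, add_zero]
      rfl
    rw [hsplit, add_comm]
  -- (1) pairing with `ψ`: `⟪ψ, D⟫ = ρ a`
  have hinner : ⟪ψ, D⟫ = ρ * a := by
    rw [hDeq, inner_add_right, inner_smul_right, inner_smul_right, inner_add_right, inner_smul_right,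
      hperp, hperp, real_inner_self_eq_norm_sq, hunit0]
    ring
  have ha_le : |ρ * a| ≤ ‖D‖ := by
    rw [← hinner]
    have := abs_real_inner_le_norm ψ D
    rwa [hunit0, one_mul] at this
  -- (2) the remainder
  have hrem : ‖(ρ * t) • ((lam' * a) • L (1, 0) + L (0, ((0 : E), wp)))‖ ≤ 2 * ‖D‖ := by
    have h1 : (ρ * t) • ((lam' * a) • L (1, 0) + L (0, ((0 : E), wp))) = D - (ρ * a) • ψ := by
      rw [hDeq]; abel
    rw [h1]
    calc ‖D - (ρ * a) • ψ‖ ≤ ‖D‖ + ‖(ρ * a) • ψ‖ := norm_sub_le _ _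
      _ = ‖D‖ + |ρ * a| := by rw [norm_smul, Real.norm_eq_abs, hunit0, mul_one]
      _ ≤ 2 * ‖D‖ := by linarith
  -- hence `ρ t ‖L(0,(0,wp))‖ ≤ 2‖D‖ + ρ t |λ'| |a| S ≤ (2 + ℓ S) ‖D‖`
  have hLwp : ρ * t * ‖L (0, ((0 : E), wp))‖ ≤ (2 + ℓ * S) * ‖D‖ := by
    have h1 : ‖(ρ * t) • L (0, ((0 : E), wp))‖ ≤
        ‖(ρ * t) • ((lam' * a) • L (1, 0) + L (0, ((0 : E), wp)))‖ + ‖(ρ * t) • ((lam' * a) • L (1, 0))‖ := by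
      have heq : (ρ * t) • L (0, ((0 : E), wp)) =
          (ρ * t) • ((lam' * a) • L (1, 0) + L (0, ((0 : E), wp))) - (ρ * t) • ((lam' * a) • L (1, 0)) := by
        rw [smul_add]; abel
      rw [heq]
      exact norm_sub_le _ _
    have h2 : ‖(ρ * t) • ((lam' * a) • L (1, 0))‖ ≤ ℓ * S * ‖D‖ := by
      rw [norm_smul, norm_smul, Real.norm_eq_abs, Real.norm_eq_abs, abs_of_pos (mul_pos hρ ht0), abs_mul]
      -- `ρ t |λ'| |a| ‖L(1,0)‖ = (t|λ'|) ‖L(1,0)‖ (ρ |a|) ≤ ℓ S ‖D‖`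
      have h3 : ρ * t * (|lam'| * |a| * ‖L (1, 0)‖) = (t * |lam'|) * ‖L (1, 0)‖ * (ρ * |a|) := by ring
      rw [h3]
      have h4 : (t * |lam'|) * ‖L (1, 0)‖ ≤ ℓ * S := mul_le_mul hℓ hS (norm_nonneg _) hℓ0
      have h5 : ρ * |a| ≤ ‖D‖ := by
        have : |ρ * a| = ρ * |a| := by rw [abs_mul, abs_of_pos hρ]
        rw [← this]; exact ha_le
      exact mul_le_mul h4 h5 (mul_nonneg hρ.le (abs_nonneg _)) (mul_nonneg hℓ0 hS0)
    rw [norm_smul, Real.norm_eq_abs, abs_of_pos (mul_pos hρ ht0)] at h1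
    linarith
  -- (3) the angular hypothesis on `wp ⊥ y`: `κ ‖wp‖ ≤ t ‖L(0,(0,wp))‖`
  have hwp_le : ρ * κ * ‖wp‖ ≤ (2 + ℓ * S) * ‖D‖ := by
    have h := hang wp hwp_perp
    have h' : ρ * (κ * ‖wp‖) ≤ ρ * (t * ‖L (0, ((0 : E), wp))‖) := mul_le_mul_of_nonneg_left h hρ.le
    calc ρ * κ * ‖wp‖ = ρ * (κ * ‖wp‖) := by ring
      _ ≤ ρ * (t * ‖L (0, ((0 : E), wp))‖) := h'
      _ = ρ * t * ‖L (0, ((0 : E), wp))‖ := by ring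
      _ ≤ (2 + ℓ * S) * ‖D‖ := hLwp
  -- (4) assemble: `‖w‖ ≤ |a| + ‖wp‖`
  have hw_le : ‖w‖ ≤ |a| + ‖wp‖ := by
    have h1 : w = a • yh + wp := by rw [hwp, add_sub_cancel]
    calc ‖w‖ = ‖a • yh + wp‖ := by rw [← h1]
      _ ≤ ‖a • yh‖ + ‖wp‖ := norm_add_le _ _
      _ = |a| + ‖wp‖ := by rw [norm_smul, Real.norm_eq_abs, hyh1, mul_one]
  have hρa : ρ * κ * |a| ≤ κ * ‖D‖ := by
    have : ρ * |a| ≤ ‖D‖ := by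
      have h' : |ρ * a| = ρ * |a| := by rw [abs_mul, abs_of_pos hρ]
      rw [← h']; exact ha_le
    nlinarith [hκ.le]
  calc ρ * κ * ‖w‖ ≤ ρ * κ * (|a| + ‖wp‖) := mul_le_mul_of_nonneg_left hw_le (mul_nonneg hρ.le hκ.le)
    _ = ρ * κ * |a| + ρ * κ * ‖wp‖ := by ring
    _ ≤ κ * ‖D‖ + (2 + ℓ * S) * ‖D‖ := add_le_add hρa hwp_le
    _ = (κ + 2 + ℓ * S) * ‖D‖ := by ring

end Literature.Topology.FourManifolds
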